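import Summits.AtomisticToContinuum.Crystallization.Theorems.ThreeConeCertificateExactCertificateFarEqualSliceMaxPow
import Summits.AtomisticToContinuum.Crystallization.Theorems.ThreeConeCertificateExactCertificateFarEqualCosTaylor
import Summits.AtomisticToContinuum.Crystallization.Theorems.ThreeConeCertificateExactCertificateFarEqualRemEntire
import Summits.AtomisticToContinuum.Crystallization.Theorems.ThreeConeCertificateExactCertificateFarEqualRemScaling
import Literature.MathematicalPhysics.StatisticalMechanics.LennardJonesClusters
import HarnessLib

/-!
# Crux `ExactCertificate` (stmt-AtomisticToContinuum-11959), line `closure-makes-nogap-exact`, skeleton IX: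
# THE SLACK CONE IS ACTIVE BEYOND EVERY RADIUS — the census's strengthening S⁺₂ ("`U ≡ 0` beyond `ρ′`") REFUTED

Support file for the crux `ThreeConeCertificate.ExactCertificate` (registered assembly stub `stub_farEqualAssembly` = the
deciding statement `Cruxes.ExactCertificate.FarEqual.FarSlackActive` of skeleton IX; the lead's analytic input `stub_sliceMaxPow` is
`…FarEqualSliceMaxPow.lean`).  Nothing here closes the 3-D crux (`NoGap ∧ KeplerBound`, `KeplerBound` = item 11961 ↔
0627 open).  What is proved is the first GENUINE (not `…FalseOf<H>`) refutation of a sub-class of exact three-cone certificates on the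
far-field side of the dossier (`Cruxes/ExactCertificate/STRATEGY-CENSUS.md` §3, S⁺₂: "exact certificate with `U ≡ 0` beyond some ρ′"
— the FORM the d = 1 certificate has, Transfer I/V: `U ≡ 0`, `f = V` beyond the first shell):

* `stub_farEqualAssembly` (= `FarSlackActive`): for every exact three-cone certificate `(P, ρ, c, g, U, f)` of the crux — the six
  clauses VERBATIM — whose Bochner kernel `f` is measurable and whose template `P` has a commensurate motif (`q(x − x′) ∈ G` for motif
  points; automatic for Bravais templates, `q = 6` for hcp), and every radius `ρ′`, there is `r ≥ ρ′` with `U r ≠ 0`.  Corollaries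
  `bravais_farSlackActive`, `hcp_farSlackActive`, `fcc_farSlackActive`.
* `stub_sliceMaxPow`: for `m ≥ 3`, `ρ > 0` the slice `s ↦ 𝓕[max(‖·‖², ρ²)^{−m}](s e₀)` of the capped power on `ℝ³` coincides on
  `s > 0` with an entire function of exponential type (slice bridge `ℝ³ = ℝ × ℝ²`, explicit plank profile, and the cosine transform of
  the power tail made entire by Taylor subtraction + scaling — stubs F0–F6 of the skeleton, all landed).

Proof of the refutation.  If `U ≡ 0` on `[ρ′, ∞)` then `f = V_LJ` on `[ρ″, ∞)`, `ρ″ = max ρ ρ′ 1`; `F = f∘‖·‖` is integrable, so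
Bragg-peak vanishing (`…StrictCertificateBragg.structureFactor_mul_fourier_eq_zero`) and `structureFactor_dilate_ne_zero` give
`𝓕F = 0` on a dilated dual plane minus `0`.  Split `F = H + G`, `G = V_LJ(max(‖·‖, ρ″)) = (1/12)W₆ − (1/6)W₃`, `H` of compact support:
`Ξ = Φ_H + (1/12)Θ₆ − (1/6)Θ₃` (`…Invisibility.stub_sliceEntire`, `stub_sliceMaxPow`) is entire of exponential type, equals `𝓕F(s e₀)`
for `s > 0`, vanishes at the norms of the dual plane, hence `Ξ ≡ 0` by the ENGINE of skeleton VIII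
(`entire_eq_zero_of_vanish_on_latticeNorms`); so `𝓕F = 0` off the origin (radiality), everywhere (continuity), `F = 0` at the continuity
point `(ρ″+1)e₀` (Fourier inversion) — but there `F = V_LJ(ρ″ + 1) < 0`.  All `[folklore]`.
-/

noncomputable section

namespace Summit.AtomisticToContinuum.Crystallization.Theorems.ThreeConeCertificateExactCertificate.FarEqual

open Literature.MathematicalPhysics.StatisticalMechanics MeasureTheory Set Filter Topology
open Summit.AtomisticToContinuum.Crystallization.Theorems.ChargedEnergyGapNegative (E3)
open Summit.AtomisticToContinuum.Crystallization.Theorems.ExactCertificateNegative (IsSplit)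
open Summit.AtomisticToContinuum.Crystallization.Theorems.BraggSlacknessRigidityStrictCertificate
  (structureFactor_mul_fourier_eq_zero hcp_periods_mem hcp_barlowPos_zero_one hcp_motif_eq)
open Summit.AtomisticToContinuum.Crystallization.Theorems.ThreeConeCertificateExactCertificate.Invisibility
open scoped BigOperators FourierTransform RealInnerProductSpace

/-! ## Commensurate templates have a non-vanishing structure factor on a dilated dual plane -/

/-- For a template with commensurate motif (`q(x − x′) ∈ G`) and a dual vector `k`, every phase `e^{−2πi⟨x, qk⟩}`, `x ∈ motif`, equals
the phase of a fixed motif point, so the structure factor at `qk` is `#motif · e^{−2πi⟨x₀,qk⟩} ≠ 0`. [folklore] -/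
theorem structureFactor_dilate_ne_zero (P : PeriodicConfiguration 3) {q : ℕ}
    (hcomm : ∀ x ∈ P.motif, ∀ x' ∈ P.motif, (q : ℝ) • (x - x') ∈ P.lattice) {k : E3}
    (hk : ∀ g ∈ P.lattice, ∃ m : ℤ, ⟪k, g⟫ = (m : ℝ)) :
    (∑ x ∈ P.motif, Complex.exp (↑(-2 * Real.pi * ⟪x, (q : ℝ) • k⟫) * Complex.I)) ≠ 0 := by
  obtain ⟨x₀, hx₀⟩ := P.motif_nonempty
  have hphase : ∀ x ∈ P.motif,
      Complex.exp (↑(-2 * Real.pi * ⟪x, (q : ℝ) • k⟫) * Complex.I) =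
        Complex.exp (↑(-2 * Real.pi * ⟪x₀, (q : ℝ) • k⟫) * Complex.I) := by
    intro x hx
    obtain ⟨m, hm⟩ := hk _ (hcomm x hx x₀ hx₀)
    have hxq : ⟪x, (q : ℝ) • k⟫ = ⟪x₀, (q : ℝ) • k⟫ + m := by
      have h1 : ⟪(q : ℝ) • (x - x₀), k⟫ = ⟪x, (q : ℝ) • k⟫ - ⟪x₀, (q : ℝ) • k⟫ := by
        rw [real_inner_smul_left, inner_sub_left, real_inner_smul_right, real_inner_smul_right]
        ring
      rw [real_inner_comm] at hm
      linarith [hm, h1]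
    rw [hxq, show ((-2 * Real.pi * (⟪x₀, (q : ℝ) • k⟫ + (m : ℝ)) : ℝ) : ℂ) * Complex.I =
        ↑(-2 * Real.pi * ⟪x₀, (q : ℝ) • k⟫) * Complex.I + ((-m : ℤ) : ℂ) * (2 * Real.pi * Complex.I) by
      push_cast; ring, Complex.exp_add, Complex.exp_int_mul_two_pi_mul_I, mul_one]
  rw [Finset.sum_congr rfl hphase, Finset.sum_const, nsmul_eq_mul]
  exact mul_ne_zero (by exact_mod_cast (Finset.card_pos.2 ⟨x₀, hx₀⟩).ne') (Complex.exp_ne_zero _)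

/-! ## The refutation -/
/-- `|V_LJ(r)| (1 + r)⁶ ≤ 16` for `r ≥ 1`. [folklore] -/
theorem abs_lennardJones_mul_le {r : ℝ} (hr : 1 ≤ r) : |lennardJones r| * (1 + r) ^ 6 ≤ 16 := by
  have hr0 : 0 < r := by linarith
  set u : ℝ := r⁻¹ with hu
  have hu0 : 0 < u := inv_pos.2 hr0
  have hu1 : u ≤ 1 := inv_le_one_of_one_le₀ hr
  have h1 : |lennardJones r| ≤ u ^ 6 / 4 := by
    unfold lennardJones
    rw [← hu]
    have h12 : u ^ 12 ≤ u ^ 6 := pow_le_pow_of_le_one hu0.le hu1 (by norm_num)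
    rw [abs_le]
    constructor <;> nlinarith [pow_pos hu0 12, pow_pos hu0 6]
  have h2 : (1 + r) * u ≤ 2 := by
    rw [hu, add_mul, mul_inv_cancel₀ hr0.ne', one_mul]; linarith [hu1]
  calc |lennardJones r| * (1 + r) ^ 6 ≤ u ^ 6 / 4 * (1 + r) ^ 6 := by gcongr
    _ = ((1 + r) * u) ^ 6 / 4 := by ring
    _ ≤ 2 ^ 6 / 4 := by gcongr
    _ = 16 := by norm_num

/-- **Registered assembly stub `stub_farEqualAssembly` = the deciding statement `FarSlackActive` of skeleton IX: THE SLACK CONE IS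
ACTIVE BEYOND EVERY RADIUS.**  For every exact three-cone certificate `(P, ρ, c, g, U, f)` (the six clauses of the crux verbatim) with
measurable Bochner kernel `f` and a commensurate motif, and every radius `ρ′`, there is `r ≥ ρ′` with `U r ≠ 0`.  Equivalently: no
exact certificate at such a template has `U ≡ 0` beyond a finite radius (census S⁺₂) — the d = 1 form of the certificate does not exist
in d = 3. [folklore] -/
theorem stub_farEqualAssembly :
    ∀ (P : Literature.MathematicalPhysics.StatisticalMechanics.PeriodicConfiguration 3) (ρ c : ℝ) (g U f : ℝ → ℝ),
    (∀ r : ℝ, 0 < r → Literature.MathematicalPhysics.StatisticalMechanics.lennardJones r = g r + U r + f r) →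
    (∀ r : ℝ, 0 < r → 0 ≤ U r) →
    (∀ r : ℝ, ρ ≤ r → g r = 0) →
    (∀ (n : ℕ) (y : Fin n → EuclideanSpace ℝ (Fin 3)) (w : Fin n → ℝ),
      0 ≤ ∑ i, ∑ j, w i * w j * f (dist (y i) (y j))) →
    (∀ (N : ℕ) (x : Fin N → EuclideanSpace ℝ (Fin 3)), Function.Injective x →
      -(c * (N : ℝ)) ≤ Literature.MathematicalPhysics.StatisticalMechanics.interactionEnergy g x) →
    c + f 0 / 2 = -(P.energyPerParticle Literature.MathematicalPhysics.StatisticalMechanics.lennardJones) →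
    Measurable f →
    (∃ q : ℕ, 0 < q ∧ ∀ x ∈ P.motif, ∀ x' ∈ P.motif, (q : ℝ) • (x - x') ∈ P.lattice) →
    ∀ ρ' : ℝ, ∃ r : ℝ, ρ' ≤ r ∧ U r ≠ 0 := by
  intro P ρ c g U f h1 h2 h3 h4 h5 hval hfm hcomm ρ'
  by_contra hno
  have hU0 : ∀ r : ℝ, ρ' ≤ r → U r = 0 := fun r hr => by by_contra h; exact hno ⟨r, hr, h⟩
  have hs : IsSplit ρ c g U f := ⟨h1, h2, h3, h4, h5⟩
  -- the radius beyond which `f = V`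
  set ρ'' : ℝ := max (max ρ ρ') 1 with hρ''
  have hρ''1 : 1 ≤ ρ'' := le_max_right _ _
  have hρ''pos : 0 < ρ'' := by linarith
  have hρρ'' : ρ ≤ ρ'' := (le_max_left _ _).trans (le_max_left _ _); have hρ'ρ'' : ρ' ≤ ρ'' := (le_max_right _ _).trans (le_max_left _ _)
  have hfV : ∀ r : ℝ, ρ'' ≤ r → f r = lennardJones r := by
    intro r hr
    rw [hs.f_eq_tail (hρρ''.trans hr) (hρ''pos.trans_le hr), hU0 r (hρ'ρ''.trans hr), sub_zero]
  -- the kernel on `ℝ³` and its integrability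
  set F : E3 → ℂ := fun v => (f ‖v‖ : ℂ) with hFdef
  have hFmeas : AEStronglyMeasurable F volume :=
    (Complex.continuous_ofReal.measurable.comp (hfm.comp measurable_norm)).aestronglyMeasurable
  set C : ℝ := max (f 0 * (1 + ρ'') ^ 6) 16 with hC
  have hbound : ∀ v : E3, ‖F v‖ ≤ C * (1 + ‖v‖) ^ (-(6 : ℝ)) := by
    intro v
    rw [Real.rpow_neg (by positivity), show (6 : ℝ) = ((6 : ℕ) : ℝ) by norm_num, Real.rpow_natCast,
      ← div_eq_mul_inv, le_div_iff₀ (by positivity)]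
    simp only [hFdef, Complex.norm_real, Real.norm_eq_abs]
    by_cases hv : ‖v‖ ≤ ρ''
    · calc |f ‖v‖| * (1 + ‖v‖) ^ 6 ≤ f 0 * (1 + ρ'') ^ 6 := by
            gcongr
            · exact hs.f_zero_nonneg
            · exact hs.abs_f_le (norm_nonneg _)
        _ ≤ C := le_max_left _ _
    · rw [not_le] at hv
      rw [hfV ‖v‖ hv.le]
      exact (abs_lennardJones_mul_le (hρ''1.trans hv.le)).trans (le_max_right _ _)
  have hFi : Integrable F := by
    refine ((integrable_one_add_norm (E := E3) (μ := volume) (r := 6) ?_).const_mul C).mono' hFmeas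
      (ae_of_all _ hbound)
    rw [finrank_euclideanSpace_fin]; norm_num
  -- Bragg-peak vanishing at dual vectors; commensurate motif ⇒ `𝓕F = 0` on a dilated dual plane
  obtain ⟨q, hq, hcomm⟩ := hcomm
  obtain ⟨k₁, k₂, hli, hk₁, hk₂⟩ := exists_dualVectors P
  have hq0 : (q : ℝ) ≠ 0 := by exact_mod_cast hq.ne'
  have hli' : LinearIndependent ℝ ![(q : ℝ) • k₁, (q : ℝ) • k₂] := by
    rw [LinearIndependent.pair_iff] at hli ⊢
    intro s t hst
    have h := hli (s * q) (t * q) (by rw [mul_smul, mul_smul]; exact hst)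
    exact ⟨(mul_eq_zero.1 h.1).resolve_right hq0, (mul_eq_zero.1 h.2).resolve_right hq0⟩
  have hzF : ∀ n j : ℤ, (n, j) ≠ (0, 0) →
      𝓕 F ((n : ℝ) • ((q : ℝ) • k₁) + (j : ℝ) • ((q : ℝ) • k₂)) = 0 := by
    intro n j _
    set k : E3 := (n : ℝ) • k₁ + (j : ℝ) • k₂ with hkdef
    have hkdual : ∀ g' ∈ P.lattice, ∃ m : ℤ, ⟪k, g'⟫ = (m : ℝ) := by
      intro g' hg'
      obtain ⟨p₁, hp₁⟩ := hk₁ g' hg'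
      obtain ⟨p₂, hp₂⟩ := hk₂ g' hg'
      refine ⟨n * p₁ + j * p₂, ?_⟩
      rw [hkdef, inner_add_left, real_inner_smul_left, real_inner_smul_left, hp₁, hp₂]
      push_cast
      ring
    have hqkdual : ∀ g' ∈ P.lattice, ∃ m : ℤ, ⟪(q : ℝ) • k, g'⟫ = (m : ℝ) := by
      intro g' hg'
      obtain ⟨m, hm⟩ := hkdual g' hg'
      exact ⟨q * m, by rw [real_inner_smul_left, hm]; push_cast; ring⟩
    have hqk : (n : ℝ) • ((q : ℝ) • k₁) + (j : ℝ) • ((q : ℝ) • k₂) = (q : ℝ) • k := by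
      rw [hkdef, smul_add, smul_comm (n : ℝ) (q : ℝ) k₁, smul_comm (j : ℝ) (q : ℝ) k₂]
    have h := structureFactor_mul_fourier_eq_zero hs hval.le hFi hqkdual
    rw [hqk]
    exact (mul_eq_zero.1 h).resolve_left (structureFactor_dilate_ne_zero P hcomm hkdual)
  -- the explicit tail model `G = V_LJ(max(‖·‖, ρ″))` and the compactly supported `H = F − G`
  set W : ℕ → E3 → ℂ := fun m v => ((((max (‖v‖ ^ 2) (ρ'' ^ 2))⁻¹) ^ m : ℝ) : ℂ) with hWdef
  set G : E3 → ℂ := fun v => (1 / 12 : ℂ) * W 6 v - (1 / 6 : ℂ) * W 3 v with hGdef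
  have hGF : ∀ v : E3, ρ'' ≤ ‖v‖ → G v = F v := by
    intro v hv
    have hv0 : 0 < ‖v‖ := hρ''pos.trans_le hv
    have hmax : max (‖v‖ ^ 2) (ρ'' ^ 2) = ‖v‖ ^ 2 :=
      max_eq_left (pow_le_pow_left₀ hρ''pos.le hv 2)
    have e6 : ((‖v‖ ^ 2)⁻¹) ^ 6 = (‖v‖⁻¹) ^ 12 := by rw [← inv_pow, ← pow_mul]
    have e3 : ((‖v‖ ^ 2)⁻¹) ^ 3 = (‖v‖⁻¹) ^ 6 := by rw [← inv_pow, ← pow_mul]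
    simp only [hGdef, hWdef, hFdef, hmax, hfV ‖v‖ hv, lennardJones, e6, e3]
    push_cast
    ring
  set H : E3 → ℂ := fun v => F v - G v with hHdef
  have hHsupp : ∀ v : E3, ρ'' < ‖v‖ → H v = 0 := fun v hv => by
    simp only [hHdef, hGF v hv.le, sub_self]
  have hW6 : Integrable (W 6) := integrable_maxPow' hρ''pos (by norm_num)
  have hW3 : Integrable (W 3) := integrable_maxPow' hρ''pos le_rfl
  have hGi : Integrable G := (hW6.const_mul _).sub (hW3.const_mul _)
  have hHi : Integrable H := hFi.sub hGi
  -- the slices: `Φ_H` (skeleton VIII) and `Θ₃`, `Θ₆` (stub F7)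
  obtain ⟨ΦH, hΦHd, ⟨B₁, τ₁, hB₁⟩, hΦHF⟩ := stub_sliceEntire H ρ'' hHi hHsupp
  have h7 := stub_sliceMaxPow stub_fourierEntireReal stub_sliceBridge stub_planeIntegralMaxPow
    (stub_tailCosTransform (stub_remEntire stub_cosTaylorBounds) (stub_remScaling stub_cosTaylorBounds))
  obtain ⟨Θ₃, hΘ₃d, ⟨B₃, τ₃, hB₃⟩, hΘ₃F⟩ := h7 3 ρ'' le_rfl hρ''pos
  obtain ⟨Θ₆, hΘ₆d, ⟨B₆, τ₆, hB₆⟩, hΘ₆F⟩ := h7 6 ρ'' (by norm_num) hρ''pos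
  set Ξ : ℂ → ℂ := fun z => ΦH z + ((1 / 12 : ℂ) * Θ₆ z - (1 / 6 : ℂ) * Θ₃ z) with hΞdef
  have hΞd : Differentiable ℂ Ξ := hΦHd.add ((hΘ₆d.const_mul _).sub (hΘ₃d.const_mul _))
  set T : ℝ := |τ₁| + |τ₆| + |τ₃| with hT
  have hexp : ∀ (τ : ℝ) (z : ℂ), |τ| ≤ T → Real.exp (τ * ‖z‖) ≤ Real.exp (T * ‖z‖) := fun τ z hτ =>
    Real.exp_le_exp.2 (mul_le_mul_of_nonneg_right ((le_abs_self τ).trans hτ) (norm_nonneg z))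
  have hΞB : ∀ z : ℂ, ‖Ξ z‖ ≤ (|B₁| + |B₆| + |B₃|) * Real.exp (T * ‖z‖) := by
    intro z
    have hτ₁ : |τ₁| ≤ T := by rw [hT]; linarith [abs_nonneg τ₆, abs_nonneg τ₃]
    have hτ₆ : |τ₆| ≤ T := by rw [hT]; linarith [abs_nonneg τ₁, abs_nonneg τ₃]
    have hτ₃ : |τ₃| ≤ T := by rw [hT]; linarith [abs_nonneg τ₁, abs_nonneg τ₆]
    have g₁ : ‖ΦH z‖ ≤ |B₁| * Real.exp (T * ‖z‖) :=
      (hB₁ z).trans ((mul_le_mul_of_nonneg_right (le_abs_self _) (Real.exp_pos _).le).trans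
        (mul_le_mul_of_nonneg_left (hexp τ₁ z hτ₁) (abs_nonneg _)))
    have g₆ : ‖Θ₆ z‖ ≤ |B₆| * Real.exp (T * ‖z‖) :=
      (hB₆ z).trans ((mul_le_mul_of_nonneg_right (le_abs_self _) (Real.exp_pos _).le).trans
        (mul_le_mul_of_nonneg_left (hexp τ₆ z hτ₆) (abs_nonneg _)))
    have g₃ : ‖Θ₃ z‖ ≤ |B₃| * Real.exp (T * ‖z‖) :=
      (hB₃ z).trans ((mul_le_mul_of_nonneg_right (le_abs_self _) (Real.exp_pos _).le).trans
        (mul_le_mul_of_nonneg_left (hexp τ₃ z hτ₃) (abs_nonneg _)))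
    have n₆ : ‖(1 / 12 : ℂ) * Θ₆ z‖ ≤ ‖Θ₆ z‖ := by
      rw [norm_mul]; exact mul_le_of_le_one_left (norm_nonneg _) (by norm_num)
    have n₃ : ‖(1 / 6 : ℂ) * Θ₃ z‖ ≤ ‖Θ₃ z‖ := by
      rw [norm_mul]; exact mul_le_of_le_one_left (norm_nonneg _) (by norm_num)
    calc ‖Ξ z‖ ≤ ‖ΦH z‖ + (‖(1 / 12 : ℂ) * Θ₆ z‖ + ‖(1 / 6 : ℂ) * Θ₃ z‖) :=
          (norm_add_le _ _).trans (add_le_add le_rfl (norm_sub_le _ _))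
      _ ≤ |B₁| * Real.exp (T * ‖z‖) + (|B₆| * Real.exp (T * ‖z‖) + |B₃| * Real.exp (T * ‖z‖)) := by
          gcongr
          · exact n₆.trans g₆
          · exact n₃.trans g₃
      _ = (|B₁| + |B₆| + |B₃|) * Real.exp (T * ‖z‖) := by ring
  -- linearity: `𝓕F = 𝓕H + (1/12)𝓕W₆ − (1/6)𝓕W₃`
  have hlin : ∀ ξ : E3, 𝓕 F ξ = 𝓕 H ξ + ((1 / 12 : ℂ) * 𝓕 (W 6) ξ - (1 / 6 : ℂ) * 𝓕 (W 3) ξ) := by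
    intro ξ
    set χ : E3 → ℂ := fun v => Complex.exp (↑(-2 * Real.pi * ⟪v, ξ⟫) * Complex.I) with hχ
    have hχn : ∀ v, ‖χ v‖ = 1 := fun v => Complex.norm_exp_ofReal_mul_I _
    have hχm : AEStronglyMeasurable χ volume := by
      refine Continuous.aestronglyMeasurable ?_
      rw [hχ]; fun_prop
    have hint : ∀ {K : E3 → ℂ}, Integrable K → Integrable fun v => χ v * K v := fun hK =>
      hK.bdd_mul (c := 1) hχm (ae_of_all _ fun v => (hχn v).le)
    simp only [Real.fourier_eq', smul_eq_mul]
    have eF : ∀ v, χ v * F v = χ v * H v + ((1 / 12 : ℂ) * (χ v * W 6 v) - (1 / 6 : ℂ) * (χ v * W 3 v)) := by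
      intro v; simp only [hHdef, hGdef]; ring
    rw [show (fun v => χ v * F v) = fun v => χ v * H v + ((1 / 12 : ℂ) * (χ v * W 6 v) - (1 / 6 : ℂ) * (χ v * W 3 v))
      from funext eF]
    have i6 : Integrable (fun v => (1 / 12 : ℂ) * (χ v * W 6 v)) := (hint hW6).const_mul _
    have i3 : Integrable (fun v => (1 / 6 : ℂ) * (χ v * W 3 v)) := (hint hW3).const_mul _
    have i63 : Integrable (fun v => (1 / 12 : ℂ) * (χ v * W 6 v) - (1 / 6 : ℂ) * (χ v * W 3 v)) := i6.sub i3
    rw [integral_add (hint hHi) i63, integral_sub i6 i3, integral_const_mul, integral_const_mul]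
  have hΞF : ∀ s : ℝ, 0 < s → Ξ (s : ℂ) = 𝓕 F (s • EuclideanSpace.single (0 : Fin 3) (1 : ℝ)) := by
    intro s hs0
    rw [hlin, ← hΦHF s, ← hΘ₆F s hs0, ← hΘ₃F s hs0]
  -- zeros of `Ξ` at the norms of the dilated dual plane
  have hnorm : ∀ {s : ℝ}, 0 ≤ s → ‖s • (EuclideanSpace.single (0 : Fin 3) (1 : ℝ) : E3)‖ = s := by
    intro s hs0
    rw [norm_smul, Real.norm_eq_abs, abs_of_nonneg hs0]
    simp
  have hrad := stub_fourierRadial (fun r : ℝ => (f r : ℂ))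
  have hzΞ : ∀ n j : ℤ, (n, j) ≠ (0, 0) →
      Ξ (‖(n : ℝ) • ((q : ℝ) • k₁) + (j : ℝ) • ((q : ℝ) • k₂)‖ : ℂ) = 0 := by
    intro n j hnj
    set k : E3 := (n : ℝ) • ((q : ℝ) • k₁) + (j : ℝ) • ((q : ℝ) • k₂) with hkdef
    have hk0 : k ≠ 0 := by
      intro hk
      rw [LinearIndependent.pair_iff] at hli'
      have h := hli' n j (by rw [hkdef] at hk; exact hk)
      exact hnj (by rw [Prod.mk.injEq]; exact ⟨by exact_mod_cast h.1, by exact_mod_cast h.2⟩)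
    have hkpos : 0 < ‖k‖ := norm_pos_iff.2 hk0
    rw [hΞF ‖k‖ hkpos, hrad _ k (hnorm hkpos.le)]
    exact hzF n j hnj
  have hΞ0 := entire_eq_zero_of_vanish_on_latticeNorms Ξ hΞd hΞB hli' hzΞ
  -- `𝓕F ≡ 0`
  have hF0' : ∀ ξ : E3, ξ ≠ 0 → 𝓕 F ξ = 0 := by
    intro ξ hξ
    have hξpos : 0 < ‖ξ‖ := norm_pos_iff.2 hξ
    rw [hrad ξ (‖ξ‖ • EuclideanSpace.single (0 : Fin 3) (1 : ℝ)) (by rw [hnorm hξpos.le]), ← hΞF ‖ξ‖ hξpos]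
    exact hΞ0 _
  have hcontF : Continuous (𝓕 F) :=
    VectorFourier.fourierIntegral_continuous Real.continuous_fourierChar continuous_inner hFi
  have hF0 : 𝓕 F = 0 := by
    have hclosed : IsClosed {ξ : E3 | 𝓕 F ξ = 0} := isClosed_eq hcontF continuous_const
    have hsub : ({(0 : E3)}ᶜ : Set E3) ⊆ {ξ : E3 | 𝓕 F ξ = 0} := fun ξ hξ => hF0' ξ hξ
    have hdense : Dense ({(0 : E3)}ᶜ : Set E3) := dense_compl_singleton 0
    have huniv : (Set.univ : Set E3) ⊆ {ξ : E3 | 𝓕 F ξ = 0} := by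
      rw [← hdense.closure_eq]
      exact hclosed.closure_subset_iff.2 hsub
    funext ξ
    exact huniv (Set.mem_univ ξ)
  -- Fourier inversion at a continuity point of `F` beyond `ρ″`
  set v₀ : E3 := (ρ'' + 1) • EuclideanSpace.single (0 : Fin 3) (1 : ℝ) with hv₀
  have hv₀n : ‖v₀‖ = ρ'' + 1 := hnorm (by linarith)
  have hopen : IsOpen {v : E3 | ρ'' < ‖v‖} := isOpen_lt continuous_const continuous_norm
  have hv₀mem : v₀ ∈ {v : E3 | ρ'' < ‖v‖} := by
    show ρ'' < ‖v₀‖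
    rw [hv₀n]; linarith
  have hLJcont : ContinuousOn (fun v : E3 => ((lennardJones ‖v‖ : ℝ) : ℂ)) {v : E3 | ρ'' < ‖v‖} := by
    refine Complex.continuous_ofReal.comp_continuousOn ?_
    have hne : ∀ v ∈ {v : E3 | ρ'' < ‖v‖}, ‖v‖ ≠ 0 := fun v hv => (hρ''pos.trans hv).ne'
    unfold lennardJones
    refine ContinuousOn.sub (ContinuousOn.mul continuousOn_const ((continuous_norm.continuousOn.inv₀ hne).pow 12))
      (ContinuousOn.mul continuousOn_const ((continuous_norm.continuousOn.inv₀ hne).pow 6))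
  have hFeq : Set.EqOn F (fun v : E3 => ((lennardJones ‖v‖ : ℝ) : ℂ)) {v : E3 | ρ'' < ‖v‖} := by
    intro v hv
    simp only [hFdef, hfV ‖v‖ (le_of_lt hv)]
  have hFcontAt : ContinuousAt F v₀ := by
    have hc1 : ContinuousAt (fun v : E3 => ((lennardJones ‖v‖ : ℝ) : ℂ)) v₀ :=
      (hLJcont v₀ hv₀mem).continuousAt (hopen.mem_nhds hv₀mem)
    exact hc1.congr_of_eventuallyEq (Filter.eventuallyEq_of_mem (hopen.mem_nhds hv₀mem) hFeq)
  have hinv := hFi.fourierInv_fourier_eq (by rw [hF0]; exact integrable_zero _ _ _) hFcontAt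
  rw [hF0, Real.fourierInv_eq'] at hinv
  simp only [Pi.zero_apply, smul_zero, integral_zero] at hinv
  -- `F v₀ = V_LJ(ρ″ + 1) < 0`, contradiction
  have hFv₀ : F v₀ = (lennardJones (ρ'' + 1) : ℂ) := by
    simp only [hFdef, hv₀n, hfV (ρ'' + 1) (by linarith)]
  have hneg : lennardJones (ρ'' + 1) < 0 := lennardJones_neg (by linarith)
  have : (lennardJones (ρ'' + 1) : ℂ) = 0 := by rw [← hFv₀, ← hinv]
  exact hneg.ne (by exact_mod_cast this)


/-! ## Templates: Bravais, hcp, fcc -/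
/-- A one-point motif is commensurate (`q = 1`). [folklore] -/
theorem commensurate_of_card_eq_one (P : PeriodicConfiguration 3) (hP : P.motif.card = 1) :
    ∃ q : ℕ, 0 < q ∧ ∀ x ∈ P.motif, ∀ x' ∈ P.motif, (q : ℝ) • (x - x') ∈ P.lattice := by
  obtain ⟨x₀, hx₀⟩ := Finset.card_eq_one.1 hP
  refine ⟨1, one_pos, fun x hx x' hx' => ?_⟩
  rw [hx₀, Finset.mem_singleton] at hx hx'; rw [hx, hx', sub_self, smul_zero]; exact P.lattice.zero_mem

/-- The hcp motif `{0, w + h e₃}` is commensurate with `q = 6` (`6(w + h e₃) = 2(u + v) + 3(2h e₃)`). [folklore] -/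
theorem hcp_commensurate {a h : ℝ} (ha : a ≠ 0) (hh : h ≠ 0) :
    ∃ q : ℕ, 0 < q ∧ ∀ x ∈ (hcpPeriodicConfiguration ha hh).motif, ∀ x' ∈ (hcpPeriodicConfiguration ha hh).motif,
      (q : ℝ) • (x - x') ∈ (hcpPeriodicConfiguration ha hh).lattice := by
  refine ⟨6, by norm_num, ?_⟩
  obtain ⟨hu, hv, h2⟩ := hcp_periods_mem ha hh
  obtain ⟨h0, h1⟩ := hcp_barlowPos_zero_one a h
  have hper : (6 : ℝ) • (barlowOffset a + layerNormal h) ∈ (hcpPeriodicConfiguration ha hh).lattice := by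
    have h3w := three_smul_barlowOffset a
    have : (6 : ℝ) • (barlowOffset a + layerNormal h) =
        (2 : ℝ) • (triangularVec₁ a + triangularVec₂ a) + (3 : ℝ) • ((2 : ℝ) • layerNormal h) := by
      rw [← h3w, smul_smul, smul_smul, smul_add]; norm_num
    rw [this]
    refine (hcpPeriodicConfiguration ha hh).lattice.add_mem ?_ ?_
    · rw [show (2 : ℝ) • (triangularVec₁ a + triangularVec₂ a) =
          ((2 : ℤ) : ℝ) • (triangularVec₁ a + triangularVec₂ a) by norm_num, Int.cast_smul_eq_zsmul]
      exact Submodule.smul_mem _ _ (Submodule.add_mem _ hu hv)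
    · rw [show (3 : ℝ) • ((2 : ℝ) • layerNormal h) = ((3 : ℤ) : ℝ) • ((2 : ℝ) • layerNormal h) by norm_num,
        Int.cast_smul_eq_zsmul]
      exact Submodule.smul_mem _ _ h2
  have hneg : (6 : ℝ) • (-(barlowOffset a + layerNormal h)) ∈ (hcpPeriodicConfiguration ha hh).lattice :=
    smul_neg (6 : ℝ) (barlowOffset a + layerNormal h) ▸ Submodule.neg_mem _ hper
  have hcases : ∀ m ∈ Finset.range 2, barlowPos a h alternatingHagg m 0 0 = 0 ∨
      barlowPos a h alternatingHagg m 0 0 = barlowOffset a + layerNormal h := by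
    intro m hm
    have hm2 := Finset.mem_range.1 hm
    interval_cases m
    · exact Or.inl (by exact_mod_cast h0)
    · exact Or.inr (by exact_mod_cast h1)
  intro x hx x' hx'
  rw [hcp_motif_eq, Finset.mem_image] at hx hx'
  obtain ⟨m, hm, rfl⟩ := hx
  obtain ⟨m', hm', rfl⟩ := hx'
  push_cast
  rcases hcases m hm with e | e <;> rcases hcases m' hm' with e' | e' <;> rw [e, e']
  · simp
  · simpa using hneg
  · simpa using hper
  · simp

/-- **Bravais templates**: the slack cone of an exact certificate with measurable kernel is active beyond every radius. [folklore] -/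
theorem bravais_farSlackActive (P : PeriodicConfiguration 3) (hP : P.motif.card = 1) {ρ c : ℝ} {g U f : ℝ → ℝ}
    (hs : IsSplit ρ c g U f) (hval : c + f 0 / 2 = -(P.energyPerParticle lennardJones)) (hfm : Measurable f)
    (ρ' : ℝ) : ∃ r : ℝ, ρ' ≤ r ∧ U r ≠ 0 :=
  stub_farEqualAssembly P ρ c g U f hs.1 hs.2.1 hs.2.2.1 hs.2.2.2.1 hs.2.2.2.2 hval hfm
    (commensurate_of_card_eq_one P hP) ρ'

/-- **hcp templates** (the dossier's expected minimiser; home of item 13167): the slack cone is active beyond every radius. [folklore] -/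
theorem hcp_farSlackActive {a h : ℝ} (ha : a ≠ 0) (hh : h ≠ 0) {ρ c : ℝ} {g U f : ℝ → ℝ}
    (hs : IsSplit ρ c g U f)
    (hval : c + f 0 / 2 = -((hcpPeriodicConfiguration ha hh).energyPerParticle lennardJones)) (hfm : Measurable f)
    (ρ' : ℝ) : ∃ r : ℝ, ρ' ≤ r ∧ U r ≠ 0 :=
  stub_farEqualAssembly _ ρ c g U f hs.1 hs.2.1 hs.2.2.1 hs.2.2.2.1 hs.2.2.2.2 hval hfm (hcp_commensurate ha hh) ρ'

/-- **fcc templates** (one-point motif). [folklore] -/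
theorem fcc_farSlackActive {a h : ℝ} (ha : a ≠ 0) (hh : h ≠ 0) {ρ c : ℝ} {g U f : ℝ → ℝ}
    (hs : IsSplit ρ c g U f)
    (hval : c + f 0 / 2 = -((fccPeriodicConfiguration ha hh).energyPerParticle lennardJones)) (hfm : Measurable f)
    (ρ' : ℝ) : ∃ r : ℝ, ρ' ≤ r ∧ U r ≠ 0 :=
  bravais_farSlackActive _ (by rfl) hs hval hfm ρ'

end Summit.AtomisticToContinuum.Crystallization.Theorems.ThreeConeCertificateExactCertificate.FarEqual

end
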